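import Summits.AnomalousDissipation.AnomalousDissipation.Theorems.SolenoidalFractalHomogenisationLagrangianStepCellLawVSlowGraphBall
import Literature.Analysis.FunctionSpaces.DoubledPairingLimit
import Mathlib.Analysis.ODE.ExistUnique
import HarnessLib

/-!
# K1L `LagrangianRenormalisationStep(Design)` (K1L_D, stmt-AnomalousDissipation-27980; aside 24912), stub `stub_cellLawV0_IS`
# — the ABSTRACT SLOW-GRAPH LEVER, part 3: EXISTENCE of Chang's Riccati graph from `L(0) = 0` on a whole window `[0, T]`
# (helper; `--supports stmt-AnomalousDissipation-27980`; word-independent)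

Summits-side helper file of route `SolenoidalFractalHomogenisation` (planner ad-ideate-p5's STUB-PLAN for `stub_cellLawV` §1 (V) V1/V2, crux idea
`chang-slow-graph`, `Cruxes/LagrangianRenormalisationStep/SlowGraphSketch.lean` §G), on top of part 1 `…CellLawVSlowGraphBall` (G1 `riccatiInvariantBall`,
p661616).  The registered lever G1–G3 quantifies over a GIVEN solution `L` of `L̇ = A₂₁ + A₂₂L − LA₁₁ − LA₁₂L`; to instantiate it on the Galerkin cell
system one needs the solution from the empty graph `L(0) = 0` to EXIST on the whole refresh window — globally in time although the vector field is quadratic.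
PROVED here (`riccatiGraph_exists`): for continuous coefficients on `[0, T]` under G1's hypotheses (`γ`-dissipative fast block, `‖A₁₁‖ ≤ s₀ < γ`, couplings
`≤ δ`, `8δ² ≤ (γ−s₀)²`) there is `L` with `L 0 = 0`, continuous on `[0, T]`, solving the Riccati equation (two-sided `HasDerivAt`, as G1–G3 are typed) on
`[0, T)`, and `‖L t‖ ≤ r = 2δ/(γ−s₀)` throughout.
METHOD.  Compose the field with the RADIAL RETRACTION `X ↦ (r / max r ‖X‖)•X` onto the ball of radius `r` (2-Lipschitz, `norm_sub_radial_le`) and clamp time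
to `[0, T]` (the retraction's range/identity facts are ad-lit's `norm_radialTrunc_le` / `radialTrunc_eq_self`, `DoubledPairingLimit`): the modified
field is bounded and globally Lipschitz, so ONE application of Mathlib's Picard–Lindelöf theorem
(`IsPicardLindelof.exists_eq_forall_mem_Icc_hasDerivWithinAt₀`) on `[−1, T]` gives a global solution; the operator-norm Dini estimate of part 1
(`frequently_slope_norm_lt_riccati`) at the points where the retraction is inactive, and the crude bound `‖L̇‖` elsewhere, fence `‖L‖` below `r`
(`image_le_of_liminf_slope_right_lt_deriv_boundary'`), so the retraction never acts and `L` solves the true equation.  (`δ = 0`: `L ≡ 0`.)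
No named facts, no new definitions, no sorry.  Kokotović–Bensoussan–Blankenship 1987 §2 Thm 2.3 (Chang 1972) is the Hurwitz-hypothesis analogue
(existence of a bounded solution of (2.29) for small `ε`).  Infrastructure for route-1's rung leaf F-D1.A0 (frontier FORMAL rung); NOT a proof of the stub,
of the crux, of Onsager's conjecture or of anomalous dissipation.  Prover seat `ad-k1l-cellLawV-w1` g3, 2026-08-28.
-/

set_option linter.dupNamespace false

noncomputable section

namespace Summit.AnomalousDissipation.AnomalousDissipation.Theorems.SolenoidalFractalHomogenisation.LagrangianStep

namespace SlowGraph

open Set Filter Topology Metric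
open scoped InnerProductSpace NNReal

/-! ## §6 The radial retraction onto a ball -/

section Radial

variable {V : Type*} [NormedAddCommGroup V] [NormedSpace ℝ V]

/- The radial retraction `X ↦ (R / max R ‖X‖)•X` (`R > 0`) lands in the closed ball of radius `R` and is the identity on it: ad-lit's
`Literature.Analysis.FunctionSpaces.norm_radialTrunc_le` / `radialTrunc_eq_self` (`DoubledPairingLimit`), reused by name. -/

/-- The radial retraction is 2-Lipschitz: `‖π X − π Y‖ ≤ 2‖X − Y‖`. [folklore] -/
theorem norm_radial_sub_radial_le {R : ℝ} (hR : 0 < R) (X Y : V) :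
    ‖(R / max R ‖X‖) • X - (R / max R ‖Y‖) • Y‖ ≤ 2 * ‖X - Y‖ := by
  set MX := max R ‖X‖ with hMX
  set MY := max R ‖Y‖ with hMY
  have hMXpos : 0 < MX := lt_max_of_lt_left hR
  have hMYpos : 0 < MY := lt_max_of_lt_left hR
  have hRMX : R ≤ MX := le_max_left _ _
  have hYMY : ‖Y‖ ≤ MY := le_max_right _ _
  have hmX1 : R / MX ≤ 1 := (div_le_one hMXpos).mpr hRMX
  have hmX0 : 0 ≤ R / MX := by positivity
  -- `πX − πY = mX•(X − Y) + (mX − mY)•Y`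
  have e : (R / MX) • X - (R / MY) • Y = (R / MX) • (X - Y) + (R / MX - R / MY) • Y := by
    rw [smul_sub, sub_smul]; abel
  rw [e]
  have h1 : ‖(R / MX) • (X - Y)‖ ≤ ‖X - Y‖ := by
    rw [norm_smul, Real.norm_eq_abs, abs_of_nonneg hmX0]
    exact mul_le_of_le_one_left (norm_nonneg _) hmX1
  have h2 : ‖(R / MX - R / MY) • Y‖ ≤ ‖X - Y‖ := by
    rw [norm_smul, Real.norm_eq_abs]
    have hdiff : |R / MX - R / MY| = R * |MY - MX| / (MX * MY) := by
      rw [div_sub_div _ _ hMXpos.ne' hMYpos.ne', abs_div, abs_of_pos (mul_pos hMXpos hMYpos)]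
      congr 1
      rw [show R * MY - MX * R = R * (MY - MX) by ring, abs_mul, abs_of_pos hR]
    have hmax : |MY - MX| ≤ ‖X - Y‖ := by
      have h := abs_max_sub_max_le_max R ‖Y‖ R ‖X‖
      rw [sub_self, abs_zero] at h
      calc |MY - MX| ≤ max 0 |‖Y‖ - ‖X‖| := h
        _ = |‖Y‖ - ‖X‖| := max_eq_right (abs_nonneg _)
        _ ≤ ‖Y - X‖ := abs_norm_sub_norm_le _ _
        _ = ‖X - Y‖ := norm_sub_rev _ _
    rw [hdiff]
    calc R * |MY - MX| / (MX * MY) * ‖Y‖ ≤ R * ‖X - Y‖ / (MX * MY) * MY := by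
          refine mul_le_mul ?_ hYMY (norm_nonneg _) (by positivity)
          exact div_le_div_of_nonneg_right (mul_le_mul_of_nonneg_left hmax hR.le) (by positivity)
      _ = (R / MX) * ‖X - Y‖ := by field_simp
      _ ≤ 1 * ‖X - Y‖ := mul_le_mul_of_nonneg_right hmX1 (norm_nonneg _)
      _ = ‖X - Y‖ := one_mul _
  calc ‖(R / MX) • (X - Y) + (R / MX - R / MY) • Y‖ ≤ ‖(R / MX) • (X - Y)‖ + ‖(R / MX - R / MY) • Y‖ := norm_add_le _ _
    _ ≤ ‖X - Y‖ + ‖X - Y‖ := add_le_add h1 h2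
    _ = 2 * ‖X - Y‖ := by ring

end Radial

/-! ## §7 The truncated Riccati field: Lipschitz and bounded -/

section Truncated

variable {E F : Type*} [NormedAddCommGroup E] [InnerProductSpace ℝ E] [NormedAddCommGroup F] [InnerProductSpace ℝ F]

/-- Lipschitz estimate for the Riccati field on a ball: for `‖P‖, ‖Q‖ ≤ R`,
`‖(A₂₂∘P − P∘A₁₁ − P∘A₁₂∘P) − (A₂₂∘Q − Q∘A₁₁ − Q∘A₁₂∘Q)‖ ≤ (‖A₂₂‖ + ‖A₁₁‖ + 2R‖A₁₂‖)‖P − Q‖`. [folklore] -/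
theorem norm_riccati_sub_riccati_le (A₁₁ : E →L[ℝ] E) (A₁₂ : F →L[ℝ] E) (A₂₁ : E →L[ℝ] F) (A₂₂ : F →L[ℝ] F) {R : ℝ}
    {P Q : E →L[ℝ] F} (hP : ‖P‖ ≤ R) (hQ : ‖Q‖ ≤ R) :
    ‖(A₂₁ + A₂₂.comp P - P.comp A₁₁ - (P.comp A₁₂).comp P) - (A₂₁ + A₂₂.comp Q - Q.comp A₁₁ - (Q.comp A₁₂).comp Q)‖ ≤
      (‖A₂₂‖ + ‖A₁₁‖ + 2 * R * ‖A₁₂‖) * ‖P - Q‖ := by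
  have hR : 0 ≤ R := le_trans (norm_nonneg _) hP
  have e : (A₂₁ + A₂₂.comp P - P.comp A₁₁ - (P.comp A₁₂).comp P) - (A₂₁ + A₂₂.comp Q - Q.comp A₁₁ - (Q.comp A₁₂).comp Q) =
      A₂₂.comp (P - Q) - (P - Q).comp A₁₁ - (((P - Q).comp A₁₂).comp P + (Q.comp A₁₂).comp (P - Q)) := by
    ext ξ
    simp only [FunLike.coe_sub, FunLike.coe_add, Pi.sub_apply, Pi.add_apply, ContinuousLinearMap.comp_apply, map_sub]
    abel
  rw [e]
  have n1 : ‖A₂₂.comp (P - Q)‖ ≤ ‖A₂₂‖ * ‖P - Q‖ := ContinuousLinearMap.opNorm_comp_le _ _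
  have n2 : ‖(P - Q).comp A₁₁‖ ≤ ‖A₁₁‖ * ‖P - Q‖ := by
    rw [mul_comm]; exact ContinuousLinearMap.opNorm_comp_le _ _
  have n3 : ‖((P - Q).comp A₁₂).comp P‖ ≤ R * ‖A₁₂‖ * ‖P - Q‖ := by
    calc ‖((P - Q).comp A₁₂).comp P‖ ≤ ‖(P - Q).comp A₁₂‖ * ‖P‖ := ContinuousLinearMap.opNorm_comp_le _ _
      _ ≤ (‖P - Q‖ * ‖A₁₂‖) * R := mul_le_mul (ContinuousLinearMap.opNorm_comp_le _ _) hP (norm_nonneg _) (by positivity)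
      _ = R * ‖A₁₂‖ * ‖P - Q‖ := by ring
  have n4 : ‖(Q.comp A₁₂).comp (P - Q)‖ ≤ R * ‖A₁₂‖ * ‖P - Q‖ := by
    calc ‖(Q.comp A₁₂).comp (P - Q)‖ ≤ ‖Q.comp A₁₂‖ * ‖P - Q‖ := ContinuousLinearMap.opNorm_comp_le _ _
      _ ≤ (‖Q‖ * ‖A₁₂‖) * ‖P - Q‖ := mul_le_mul_of_nonneg_right (ContinuousLinearMap.opNorm_comp_le _ _) (norm_nonneg _)
      _ ≤ (R * ‖A₁₂‖) * ‖P - Q‖ := mul_le_mul_of_nonneg_right (mul_le_mul_of_nonneg_right hQ (norm_nonneg _)) (norm_nonneg _)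
      _ = R * ‖A₁₂‖ * ‖P - Q‖ := by ring
  calc ‖A₂₂.comp (P - Q) - (P - Q).comp A₁₁ - (((P - Q).comp A₁₂).comp P + (Q.comp A₁₂).comp (P - Q))‖
      ≤ ‖A₂₂.comp (P - Q)‖ + ‖(P - Q).comp A₁₁‖ + (‖((P - Q).comp A₁₂).comp P‖ + ‖(Q.comp A₁₂).comp (P - Q)‖) := by
        refine (norm_sub_le _ _).trans (add_le_add (norm_sub_le _ _) (norm_add_le _ _))
    _ ≤ ‖A₂₂‖ * ‖P - Q‖ + ‖A₁₁‖ * ‖P - Q‖ + (R * ‖A₁₂‖ * ‖P - Q‖ + R * ‖A₁₂‖ * ‖P - Q‖) := by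
        exact add_le_add (add_le_add n1 n2) (add_le_add n3 n4)
    _ = (‖A₂₂‖ + ‖A₁₁‖ + 2 * R * ‖A₁₂‖) * ‖P - Q‖ := by ring

/-- Crude bound for the Riccati field on a ball: `‖P‖ ≤ R` gives `‖A₂₁ + A₂₂∘P − P∘A₁₁ − P∘A₁₂∘P‖ ≤ ‖A₂₁‖ + R‖A₂₂‖ + R‖A₁₁‖ + R²‖A₁₂‖`. [folklore] -/
theorem norm_riccati_le (A₁₁ : E →L[ℝ] E) (A₁₂ : F →L[ℝ] E) (A₂₁ : E →L[ℝ] F) (A₂₂ : F →L[ℝ] F) {R : ℝ}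
    {P : E →L[ℝ] F} (hP : ‖P‖ ≤ R) :
    ‖A₂₁ + A₂₂.comp P - P.comp A₁₁ - (P.comp A₁₂).comp P‖ ≤ ‖A₂₁‖ + R * ‖A₂₂‖ + R * ‖A₁₁‖ + R ^ 2 * ‖A₁₂‖ := by
  have hR : 0 ≤ R := le_trans (norm_nonneg _) hP
  have n1 : ‖A₂₂.comp P‖ ≤ R * ‖A₂₂‖ := by
    calc ‖A₂₂.comp P‖ ≤ ‖A₂₂‖ * ‖P‖ := ContinuousLinearMap.opNorm_comp_le _ _
      _ ≤ ‖A₂₂‖ * R := mul_le_mul_of_nonneg_left hP (norm_nonneg _)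
      _ = R * ‖A₂₂‖ := mul_comm _ _
  have n2 : ‖P.comp A₁₁‖ ≤ R * ‖A₁₁‖ :=
    (ContinuousLinearMap.opNorm_comp_le _ _).trans (mul_le_mul_of_nonneg_right hP (norm_nonneg _))
  have n3 : ‖(P.comp A₁₂).comp P‖ ≤ R ^ 2 * ‖A₁₂‖ := by
    calc ‖(P.comp A₁₂).comp P‖ ≤ ‖P.comp A₁₂‖ * ‖P‖ := ContinuousLinearMap.opNorm_comp_le _ _
      _ ≤ (‖P‖ * ‖A₁₂‖) * ‖P‖ := mul_le_mul_of_nonneg_right (ContinuousLinearMap.opNorm_comp_le _ _) (norm_nonneg _)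
      _ ≤ (R * ‖A₁₂‖) * R := mul_le_mul (mul_le_mul_of_nonneg_right hP (norm_nonneg _)) hP (norm_nonneg _) (by positivity)
      _ = R ^ 2 * ‖A₁₂‖ := by ring
  calc ‖A₂₁ + A₂₂.comp P - P.comp A₁₁ - (P.comp A₁₂).comp P‖
      ≤ ‖A₂₁ + A₂₂.comp P - P.comp A₁₁‖ + ‖(P.comp A₁₂).comp P‖ := norm_sub_le _ _
    _ ≤ (‖A₂₁ + A₂₂.comp P‖ + ‖P.comp A₁₁‖) + ‖(P.comp A₁₂).comp P‖ := by gcongr; exact norm_sub_le _ _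
    _ ≤ ((‖A₂₁‖ + ‖A₂₂.comp P‖) + ‖P.comp A₁₁‖) + ‖(P.comp A₁₂).comp P‖ := by gcongr; exact norm_add_le _ _
    _ ≤ ((‖A₂₁‖ + R * ‖A₂₂‖) + R * ‖A₁₁‖) + R ^ 2 * ‖A₁₂‖ := by gcongr
    _ = ‖A₂₁‖ + R * ‖A₂₂‖ + R * ‖A₁₁‖ + R ^ 2 * ‖A₁₂‖ := by ring

end Truncated

/-! ## §8 G0 — EXISTENCE of the Riccati graph from the empty graph `L(0) = 0` on a whole window `[0, T]` -/

section Existence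

/-- **G0 — EXISTENCE OF CHANG'S RICCATI GRAPH ON `[0, T]` from `L(0) = 0`** (the solution over which `SlowGraphSketch` G1–G3 quantify).  For coefficients
continuous on `[0, T]` satisfying G1's hypotheses (`0 < γ` follows from `0 ≤ s₀ < γ` and is not repeated) there is `L : ℝ → (E →L[ℝ] F)` with
`L 0 = 0`, continuous on `[0, T]`, solving
`L̇ = A₂₁ + A₂₂L − LA₁₁ − LA₁₂L` (two-sided derivative, as G1–G3 are typed) on `[0, T)`, and staying in the invariant ball `‖L t‖ ≤ 2δ/(γ−s₀)`.
Radial retraction + time clamp ⇒ bounded, globally Lipschitz field ⇒ one Picard–Lindelöf on `[−1, T]`; the Dini estimate of part 1 fences `‖L‖` below the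
retraction radius, so the retraction never acts. [cite: KokotovicBensoussanBlankenship1987, §2 eq. (2.29), Thm 2.3] -/
theorem riccatiGraph_exists (E F : Type) [NormedAddCommGroup E] [InnerProductSpace ℝ E] [FiniteDimensional ℝ E]
    [NormedAddCommGroup F] [InnerProductSpace ℝ F] [FiniteDimensional ℝ F]
    (A₁₁ : ℝ → E →L[ℝ] E) (A₁₂ : ℝ → F →L[ℝ] E) (A₂₁ : ℝ → E →L[ℝ] F) (A₂₂ : ℝ → F →L[ℝ] F) (γ δ s₀ T : ℝ)
    (hδ : 0 ≤ δ) (hs₀ : 0 ≤ s₀) (hsγ : s₀ < γ) (h8 : 8 * δ ^ 2 ≤ (γ - s₀) ^ 2) (hT : 0 ≤ T)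
    (hA₂₂ : ∀ t ∈ Icc 0 T, ∀ z : F, ⟪A₂₂ t z, z⟫_ℝ ≤ -γ * ‖z‖ ^ 2)
    (h₁₁ : ∀ t ∈ Icc 0 T, ‖A₁₁ t‖ ≤ s₀) (h₁₂ : ∀ t ∈ Icc 0 T, ‖A₁₂ t‖ ≤ δ) (h₂₁ : ∀ t ∈ Icc 0 T, ‖A₂₁ t‖ ≤ δ)
    (hc₁₁ : ContinuousOn A₁₁ (Icc 0 T)) (hc₁₂ : ContinuousOn A₁₂ (Icc 0 T)) (hc₂₁ : ContinuousOn A₂₁ (Icc 0 T))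
    (hc₂₂ : ContinuousOn A₂₂ (Icc 0 T)) :
    ∃ L : ℝ → E →L[ℝ] F, L 0 = 0 ∧ ContinuousOn L (Icc 0 T) ∧
      (∀ t ∈ Ico 0 T, HasDerivAt L (A₂₁ t + (A₂₂ t).comp (L t) - (L t).comp (A₁₁ t) - ((L t).comp (A₁₂ t)).comp (L t)) t) ∧
      ∀ t ∈ Icc 0 T, ‖L t‖ ≤ 2 * δ / (γ - s₀) := by
  have hgs : 0 < γ - s₀ := by linarith
  rcases hδ.eq_or_lt with hδ0 | hδpos
  · -- `δ = 0`: the couplings vanish and `L ≡ 0` solves the equation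
    refine ⟨fun _ => 0, rfl, continuousOn_const, fun t ht => ?_, fun t _ => ?_⟩
    · have hA : A₂₁ t = 0 := by
        rw [← norm_le_zero_iff]
        have h := h₂₁ t (Ico_subset_Icc_self ht)
        rwa [← hδ0] at h
      have e : A₂₁ t + (A₂₂ t).comp (0 : E →L[ℝ] F) - (0 : E →L[ℝ] F).comp (A₁₁ t) -
          (((0 : E →L[ℝ] F)).comp (A₁₂ t)).comp (0 : E →L[ℝ] F) = 0 := by
        rw [hA]; simp
      rw [e]
      exact hasDerivAt_const t _
    · rw [norm_zero, ← hδ0]; simp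
  · -- `δ > 0`
    set r := 2 * δ / (γ - s₀) with hr
    have hrpos : 0 < r := by positivity
    have h2δ : 2 * δ < γ - s₀ := by
      have h1 : (2 * δ) ^ 2 < (γ - s₀) ^ 2 := by nlinarith
      exact (pow_lt_pow_iff_left₀ (by positivity) hgs.le two_ne_zero).mp h1
    have hr1 : r < 1 := (div_lt_one hgs).mpr h2δ
    -- time clamp
    set c : ℝ → ℝ := fun t => max 0 (min t T) with hc
    have hc_mem : ∀ t, c t ∈ Icc 0 T := fun t => ⟨le_max_left _ _, max_le hT (min_le_right _ _)⟩
    have hc_id : ∀ t ∈ Icc 0 T, c t = t := fun t ht => by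
      show max 0 (min t T) = t
      rw [min_eq_left ht.2, max_eq_right ht.1]
    have hc_cont : Continuous c := continuous_const.max (continuous_id.min continuous_const)
    have hcA₁₁ : Continuous fun t => A₁₁ (c t) := hc₁₁.comp_continuous hc_cont hc_mem
    have hcA₁₂ : Continuous fun t => A₁₂ (c t) := hc₁₂.comp_continuous hc_cont hc_mem
    have hcA₂₁ : Continuous fun t => A₂₁ (c t) := hc₂₁.comp_continuous hc_cont hc_mem
    have hcA₂₂ : Continuous fun t => A₂₂ (c t) := hc₂₂.comp_continuous hc_cont hc_mem
    -- a bound for `‖A₂₂‖` on the window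
    obtain ⟨M, hM⟩ := isCompact_Icc.exists_bound_of_continuousOn hc₂₂
    have hM0 : 0 ≤ M := le_trans (norm_nonneg _) (hM 0 ⟨le_rfl, hT⟩)
    -- the retracted, clamped field
    set π : (E →L[ℝ] F) → (E →L[ℝ] F) := fun X => (r / max r ‖X‖) • X with hπ
    set g : ℝ → (E →L[ℝ] F) → (E →L[ℝ] F) := fun t X =>
      A₂₁ (c t) + (A₂₂ (c t)).comp (π X) - (π X).comp (A₁₁ (c t)) - ((π X).comp (A₁₂ (c t))).comp (π X) with hg
    have hπr : ∀ X, ‖π X‖ ≤ r := fun X => (Literature.Analysis.FunctionSpaces.norm_radialTrunc_le hrpos X).1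
    set K₀ : ℝ := M + s₀ + 2 * r * δ with hK₀
    set Lb : ℝ := δ + r * M + r * s₀ + r ^ 2 * δ with hLb
    have hK₀0 : 0 ≤ K₀ := by positivity
    have hLb0 : 0 ≤ Lb := by positivity
    have hglip : ∀ t, LipschitzWith ⟨2 * K₀, by positivity⟩ (g t) := by
      intro t
      refine LipschitzWith.of_dist_le_mul fun X Y => ?_
      rw [dist_eq_norm, dist_eq_norm]
      show ‖g t X - g t Y‖ ≤ 2 * K₀ * ‖X - Y‖
      have hct := hc_mem t
      have hcoef : ‖A₂₂ (c t)‖ + ‖A₁₁ (c t)‖ + 2 * r * ‖A₁₂ (c t)‖ ≤ K₀ := by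
        have := hM _ hct; have := h₁₁ _ hct; have := h₁₂ _ hct
        rw [hK₀]; gcongr
      calc ‖g t X - g t Y‖ ≤ (‖A₂₂ (c t)‖ + ‖A₁₁ (c t)‖ + 2 * r * ‖A₁₂ (c t)‖) * ‖π X - π Y‖ :=
            norm_riccati_sub_riccati_le _ _ _ _ (hπr X) (hπr Y)
        _ ≤ K₀ * (2 * ‖X - Y‖) := mul_le_mul hcoef (norm_radial_sub_radial_le hrpos X Y) (norm_nonneg _) hK₀0
        _ = 2 * K₀ * ‖X - Y‖ := by ring
    have hgbound : ∀ t X, ‖g t X‖ ≤ Lb := by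
      intro t X
      have hct := hc_mem t
      have := hM _ hct; have := h₁₁ _ hct; have := h₁₂ _ hct; have := h₂₁ _ hct
      calc ‖g t X‖ ≤ ‖A₂₁ (c t)‖ + r * ‖A₂₂ (c t)‖ + r * ‖A₁₁ (c t)‖ + r ^ 2 * ‖A₁₂ (c t)‖ := norm_riccati_le _ _ _ _ (hπr X)
        _ ≤ δ + r * M + r * s₀ + r ^ 2 * δ := by gcongr
    have hgcont : ∀ X, Continuous fun t => g t X := by
      intro X
      exact ((hcA₂₁.add (hcA₂₂.clm_comp continuous_const)).sub (continuous_const.clm_comp hcA₁₁)).sub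
        ((continuous_const.clm_comp hcA₁₂).clm_comp continuous_const)
    -- Picard–Lindelöf on `[-1, T]` from `L(0) = 0`
    have ht₀ : (0:ℝ) ∈ Icc (-1:ℝ) T := ⟨by norm_num, hT⟩
    have hPL : IsPicardLindelof g (⟨0, ht₀⟩ : Icc (-1:ℝ) T) (0 : E →L[ℝ] F) ⟨Lb * (T + 1), by positivity⟩ 0 ⟨Lb, hLb0⟩
        ⟨2 * K₀, by positivity⟩ :=
      { lipschitzOnWith := fun t _ => (hglip t).lipschitzOnWith
        continuousOn := fun X _ => (hgcont X).continuousOn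
        norm_le := fun t _ X _ => hgbound t X
        mul_max_le := by
          show Lb * max (T - 0) (0 - (-1)) ≤ Lb * (T + 1) - (0:ℝ)
          rw [sub_zero, zero_sub, neg_neg, sub_zero]
          exact mul_le_mul_of_nonneg_left (max_le (by linarith) (by linarith)) hLb0 }
    haveI : CompleteSpace F := FiniteDimensional.complete ℝ F
    obtain ⟨L, hL0, hLd⟩ := hPL.exists_eq_forall_mem_Icc_hasDerivWithinAt₀
    have hL00 : L 0 = 0 := hL0
    have hLd' : ∀ t ∈ Ico 0 T, HasDerivAt L (g t (L t)) t := fun t ht =>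
      (hLd t ⟨by linarith [ht.1], ht.2.le⟩).hasDerivAt (Icc_mem_nhds (by linarith [ht.1]) ht.2)
    have hLcont : ContinuousOn L (Icc 0 T) := fun t ht =>
      ((hLd t ⟨by linarith [ht.1], ht.2⟩).continuousWithinAt).mono (Icc_subset_Icc (by norm_num) le_rfl)
    -- the retracted field IS the Riccati field on the ball, on the window
    have hg_eq : ∀ t ∈ Icc 0 T, ∀ X : E →L[ℝ] F, ‖X‖ ≤ r →
        g t X = A₂₁ t + (A₂₂ t).comp X - X.comp (A₁₁ t) - (X.comp (A₁₂ t)).comp X := by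
      intro t ht X hX
      have hπX : π X = X := Literature.Analysis.FunctionSpaces.radialTrunc_eq_self hrpos hX
      simp only [hg, hπX, hc_id t ht]
    -- fencing: the solution stays in the ball
    have hball : ∀ t ∈ Icc 0 T, ‖L t‖ ≤ r := by
      have hcontn : ContinuousOn (fun t => ‖L t‖) (Icc 0 T) := continuous_norm.comp_continuousOn hLcont
      classical
      set f' : ℝ → ℝ := fun x => if ‖L x‖ ≤ r then δ + ‖L x‖ * s₀ - γ * ‖L x‖ + δ * ‖L x‖ ^ 2 else ‖g x (L x)‖ with hf'
      have hDini : ∀ x ∈ Ico 0 T, ∀ ρ, f' x < ρ → ∃ᶠ z in 𝓝[>] x, slope (fun t => ‖L t‖) x z < ρ := by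
        intro x hx ρ hρ
        have hxI := Ico_subset_Icc_self hx
        by_cases hxr : ‖L x‖ ≤ r
        · have hρ' : δ + ‖L x‖ * s₀ - γ * ‖L x‖ + δ * ‖L x‖ ^ 2 < ρ := by simpa [hf', hxr] using hρ
          have hd : HasDerivAt L (A₂₁ x + (A₂₂ x).comp (L x) - (L x).comp (A₁₁ x) - ((L x).comp (A₁₂ x)).comp (L x)) x := by
            rw [← hg_eq x hxI (L x) hxr]; exact hLd' x hx
          exact frequently_slope_norm_lt_riccati (hA₂₂ x hxI) (h₁₁ x hxI) (h₁₂ x hxI) (h₂₁ x hxI) hd hρ'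
        · have hρ' : ‖g x (L x)‖ < ρ := by simpa [hf', hxr] using hρ
          exact (hLd' x hx).hasDerivWithinAt.liminf_right_slope_norm_le hρ'
      have h0 : ‖L 0‖ ≤ r := by rw [hL00, norm_zero]; exact hrpos.le
      have key := image_le_of_liminf_slope_right_lt_deriv_boundary' (f := fun t => ‖L t‖) (f' := f') hcontn hDini
        (B := fun _ => r) (B' := fun _ => (0:ℝ)) h0 continuousOn_const (fun x _ => (hasDerivAt_const x r).hasDerivWithinAt) ?_
      · exact fun t ht => key ht
      · intro x _ hxr
        have hle : ‖L x‖ ≤ r := hxr.le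
        have ef : f' x = δ + r * s₀ - γ * r + δ * r ^ 2 := by simp only [hf', if_pos hle, hxr]
        rw [ef]
        have e : δ + r * s₀ - γ * r + δ * r ^ 2 = δ * (r ^ 2 - 1) := by
          rw [hr]; field_simp; ring
        rw [e]
        have : r ^ 2 < 1 := by nlinarith
        nlinarith
    refine ⟨L, hL00, hLcont, fun t ht => ?_, hball⟩
    rw [← hg_eq t (Ico_subset_Icc_self ht) (L t) (hball t (Ico_subset_Icc_self ht))]
    exact hLd' t ht

end Existence

end SlowGraph

end Summit.AnomalousDissipation.AnomalousDissipation.Theorems.SolenoidalFractalHomogenisation.LagrangianStep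

end
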